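import Literature.NumberTheory.QuadraticFields.QuadraticDedekindZeta
import HarnessLib

/-!
# The residue of `ζ_K` for an imaginary quadratic field, and "brightness bounds the class number"

Topic `NumberTheory/QuadraticFields`, namespace `Literature.NumberTheory.QuadraticFields.Quadratic`
(continuing `QuadraticDedekindZeta.lean`). Everything here is PROVED (theorems only).

For a quadratic field `K` with `d_K < 0`, Mathlib's residue constant of the analytic class number
formula (`NumberField.dedekindZeta_residue K = 2^{r₁}(2π)^{r₂} R h / (w √|d_K|)`,
`NumberField.tendsto_sub_one_mul_dedekindZeta_nhdsGT`) is `κ_K = 2π h_K / (w_K √|d_K|)`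
(`r₁ = 0`, `r₂ = 1`, `R_K = 1`: `nrRealPlaces_eq_zero_and_nrComplexPlaces_eq_one`,
`regulator_eq_one_of_discr_neg`):

* `dedekindZeta_residue_eq_of_discr_neg`, `dedekindZeta_residue_eq_of_discr_eq_neg` (`d_K = −d`);
* `le_classNumber_of_dedekindZeta_residue_ge` — **a lower bound `c / log d ≤ κ_K` ("brightness" of
  `K`, the effective Landau–Siegel-type currency) gives `c √d / (π log d) ≤ h_K`** (`w_K ≥ 2`).

This is the form in which class-group samplers convert an analytic lower bound for `L(1, χ_{−d}) =
κ_K` into "a positive proportion `≫ 1/log d` of the ideals of norm `≤ Y` per class".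

## References

* [NeukirchANT1999] J. Neukirch, *Algebraic Number Theory* (1999), Ch. VII §5, (5.11) (the analytic
  class number formula).
* [DavenportMNT1980] H. Davenport, *Multiplicative Number Theory*, 2nd ed., GTM 74 (1980), Ch. 6
  (`L(1, χ) = 2πh/(w√|d|)` for `d < 0`) and Ch. 21 (lower bounds for `L(1, χ)`).
-/

noncomputable section

namespace Literature.NumberTheory.QuadraticFields.Quadratic

open NumberField NumberField.InfinitePlace NumberField.Units Module

variable {K : Type*} [Field K] [NumberField K]

/-- **`κ_K = 2π h_K / (w_K √|d_K|)` for an imaginary quadratic field** (`[K : ℚ] = 2`, `d_K < 0`).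
[cite: NeukirchANT1999, Ch. VII §5 (5.11)] -/
theorem dedekindZeta_residue_eq_of_discr_neg (h2 : finrank ℚ K = 2) (hd : NumberField.discr K < 0) :
    dedekindZeta_residue K =
      2 * Real.pi * classNumber K / (torsionOrder K * Real.sqrt |(NumberField.discr K : ℝ)|) := by
  obtain ⟨h0, h1⟩ := nrRealPlaces_eq_zero_and_nrComplexPlaces_eq_one h2 hd
  rw [dedekindZeta_residue_def, h0, h1, regulator_eq_one_of_discr_neg h2 hd]
  ring

/-- **`κ_K = 2π h_K / (w_K √d)` when `d_K = −d`** (`d : ℕ`). [cite: NeukirchANT1999, Ch. VII §5 (5.11)] -/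
theorem dedekindZeta_residue_eq_of_discr_eq_neg (h2 : finrank ℚ K = 2) {d : ℕ}
    (hK : NumberField.discr K = -(d : ℤ)) :
    dedekindZeta_residue K = 2 * Real.pi * classNumber K / (torsionOrder K * Real.sqrt d) := by
  have hd : NumberField.discr K < 0 := by
    have := NumberField.discr_ne_zero K
    omega
  rw [dedekindZeta_residue_eq_of_discr_neg h2 hd, hK]
  push_cast
  rw [abs_neg, Nat.abs_cast]

/-- `w_K ≥ 2` (`−1` is a root of unity; Mathlib `even_torsionOrder`). [folklore] -/
theorem two_le_torsionOrder (K : Type*) [Field K] [NumberField K] : 2 ≤ torsionOrder K := by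
  obtain ⟨r, hr⟩ := even_torsionOrder K
  have hpos := torsionOrder_pos K
  omega

/-- **Brightness bounds the class number from below**: if `[K : ℚ] = 2`, `d_K = −d` and
`c / log d ≤ κ_K`, then `c √d / (π log d) ≤ h_K` (from `κ_K = 2π h_K/(w_K √d)` and `w_K ≥ 2`; for
`d ≤ 1` or `c ≤ 0` the left side is `≤ 0`). [cite: DavenportMNT1980, Ch. 6 (class number formula for d < 0)] -/
theorem le_classNumber_of_dedekindZeta_residue_ge (h2 : finrank ℚ K = 2) {d : ℕ}
    (hK : NumberField.discr K = -(d : ℤ)) {c : ℝ} (hc : c / Real.log d ≤ dedekindZeta_residue K) :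
    c * Real.sqrt d / (Real.pi * Real.log d) ≤ classNumber K := by
  have hh : (0 : ℝ) ≤ classNumber K := Nat.cast_nonneg _
  rcases le_or_gt (Real.log d) 0 with hlog | hlog
  · have hlog0 : Real.log d = 0 := le_antisymm hlog (Real.log_natCast_nonneg d)
    rw [hlog0, mul_zero, div_zero]
    exact hh
  rcases le_or_gt c 0 with hc0 | hc0
  · refine le_trans ?_ hh
    exact div_nonpos_of_nonpos_of_nonneg
      (mul_nonpos_of_nonpos_of_nonneg hc0 (Real.sqrt_nonneg _)) (by positivity)
  rw [dedekindZeta_residue_eq_of_discr_eq_neg h2 hK] at hc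
  have hw : (2 : ℝ) ≤ torsionOrder K := by exact_mod_cast two_le_torsionOrder K
  have hd1 : (1 : ℝ) < d := lt_of_not_ge fun hle =>
    absurd (Real.log_nonpos (Nat.cast_nonneg _) hle) (not_le.2 hlog)
  have hsq : 0 < Real.sqrt d := Real.sqrt_pos.2 (by linarith)
  rw [div_le_iff₀ (mul_pos Real.pi_pos hlog)]
  rw [div_le_div_iff₀ hlog (mul_pos (by linarith) hsq)] at hc
  have h2w : c * (2 * Real.sqrt d) ≤ c * (torsionOrder K * Real.sqrt d) :=
    mul_le_mul_of_nonneg_left (mul_le_mul_of_nonneg_right hw hsq.le) hc0.le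
  nlinarith [Real.pi_pos]

/-- The same with the hypothesis in the shape "every quadratic field of discriminant `−d` is
`c`-bright" and the conclusion for a given such field. [cite: DavenportMNT1980, Ch. 6] -/
theorem le_classNumber_of_forall_bright {d : ℕ} {c : ℝ}
    (hbright : ∀ (K : Type) [Field K] [NumberField K], finrank ℚ K = 2 →
      NumberField.discr K = -(d : ℤ) → c / Real.log d ≤ dedekindZeta_residue K)
    (K : Type) [Field K] [NumberField K] (h2 : finrank ℚ K = 2)
    (hK : NumberField.discr K = -(d : ℤ)) :
    c * Real.sqrt d / (Real.pi * Real.log d) ≤ classNumber K :=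
  le_classNumber_of_dedekindZeta_residue_ge h2 hK (hbright K h2 hK)

end Literature.NumberTheory.QuadraticFields.Quadratic

end
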